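import Literature.AlgebraicGeometry.Frobenioids.ArchimedeanSlim
import HarnessLib

/-!
# Frobenioids II, Theorem 3.6 (x) for the angular Frobenioid `A`: "if `D` is slim, then `A` is slim"
# — PROVED over any base `π : D → D₀`

Mochizuki, *The geometry of Frobenioids II: poly-Frobenioids*, Kyushu J. Math. **62** (2008)
401–460, §3, Theorem 3.6, author's kurims text pp. 36–38: preamble (p. 36) "In the notation and
terminology of Example 3.3, let `F` be one of the following Frobenioids: `C^Λ`, `A` [where, when
`F = A`, we take `Λ = ℤ`]" [cite: MochizukiFrdII2008, Thm 3.6 p.36]; item (x) (p. 38) "If `D` is slim,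
and `Λ ∈ {ℤ, ℝ}`, then `F` is also slim." [cite: MochizukiFrdII2008, Thm 3.6 (x) p.38]. Printed proof
(p. 39 l. 23): "Assertion (x) follows formally from [Mzk5], Proposition 1.13, (iii)"
[cite: MochizukiFrdII2008, Thm 3.6 (x) p.39] — [FrdI] Prop. 1.13 ("Rigidity and Slimness") is stated on
kurims p. 39 l. 36 of [FrdI], items (i)–(iii) and proof on p. 40 [cite: MochizukiFrdI2008, Prop. 1.13 (iii) p.40].

PROOF-ONLY companion (abc-iut cell, layer L1, seat abc-iut-L6-d7; PIECE 3 of abc-iut-L1-t9's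
PIECES 2026-08-25T21:10:12Z / abc-iut-L1-lead (gen 2) 21:10:34Z): `ArchFrd.Slim.thm36x_A :
Thm36x MonoidType.Z D (A π)` — EXACTLY abc-iut-L1-t9's schema `ArchFrd.Thm36x`
(`ArchimedeanBasicProperties.lean`) at `Λ = ℤ`, `D' = D`, `X' = A π`, the angular Frobenioid of
abc-iut-L1-t6's Example 3.3 (iii) (`AngularFrobenioidsRelative.lean`: the wide subcategory of
`C = C₀ ×_{D₀} D` on the isometries). The proof is that of `ArchimedeanSlim.lean` (`F = C`) run
inside `A`: every test arrow used there — the lifts `liftHom`, `liftMap` of `D_{A_D}`, the vertical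
arrow `vert f` of an isometry `f`, the slit pre-step `B^slit → B`, the degree-`2` Frobenius
endomorphism `((id, 2, λ⁻¹), id)` — is an ISOMETRY (`isIsometry_*` below), so Steps 1–3 apply
verbatim, and a component of a natural automorphism of `A_A → A`, read in `C` through `A ⊆ C`, is a
unit of `C` with trivial scalar. No new notion; nothing printed is strengthened; nothing here bears on
[IUTchIII] Cor 3.12.
-/

namespace Literature.AlgebraicGeometry.Frobenioids

open CategoryTheory Set
open scoped Pointwise

universe v u

namespace ArchFrd

namespace Slim

section Angular

variable {D : Type u} [Category.{v} D] (π : D ⥤ D0)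

/-! ### Isometries of `C`: the test arrows of the slimness proof are isometries -/

/-- An arrow of `C = C₀ ×_{D₀} D` is an isometry iff its `C₀`-component is (`Φ₀` has identity
pull-backs). [cite: MochizukiFrdII2008, Ex 3.3 (iii) p.28] -/
theorem isIsometry_iff_fst {X Y : C π} (φ : X ⟶ Y) :
    PreFrobenioid.IsIsometry (C.toElem π) φ ↔ PreFrobenioid.IsIsometry C0.toElem φ.fst := Iff.rfl

/-- An arrow of `C` with `|c| · tip_X ^ d = tip_Y` is an isometry. [cite: MochizukiFrdII2008, Ex 3.3 (iii) p.28] -/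
theorem isIsometry_of_norm_mul_tip_pow {X Y : C π} (φ : X ⟶ Y)
    (h : ‖(C0.scalar φ.fst : ℂ)‖ * X.fst.tip ^ (C0.degFr φ.fst : ℕ) = Y.fst.tip) :
    PreFrobenioid.IsIsometry (C.toElem π) φ :=
  (isIsometry_iff_fst π φ).mpr ((A0.isIsometry_iff_norm_mul_tip_pow φ.fst).mpr h)

/-- The lifted arrow `liftHom g = ((h_g, 1, 1), g)` is an isometry (same tip). [cite: MochizukiFrdII2008, Thm 3.6 (x) p.38] -/
theorem isIsometry_liftHom (A : C π) (g : Over A.snd) :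
    PreFrobenioid.IsIsometry (C.toElem π) (liftHom π A g) :=
  isIsometry_of_norm_mul_tip_pow π _ (by
    change ‖((1 : ℂˣ) : ℂ)‖ * A.fst.tip ^ ((1 : ℕ+) : ℕ) = A.fst.tip
    rw [Units.val_one, norm_one, one_mul, PNat.one_coe, pow_one])

/-- The lift `liftMap k = ((h_k, 1, 1), k)` is an isometry. [cite: MochizukiFrdII2008, Thm 3.6 (x) p.38] -/
theorem isIsometry_liftMap (A : C π) {g' g : Over A.snd} (k : g' ⟶ g) :
    PreFrobenioid.IsIsometry (C.toElem π) (liftMap π A k) :=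
  isIsometry_of_norm_mul_tip_pow π _ (by
    change ‖((1 : ℂˣ) : ℂ)‖ * A.fst.tip ^ ((1 : ℕ+) : ℕ) = A.fst.tip
    rw [Units.val_one, norm_one, one_mul, PNat.one_coe, pow_one])

/-- The vertical arrow `vert f` of an ISOMETRY `f` is an isometry (same scalar, degree and tips).
[cite: MochizukiFrdII2008, Thm 3.6 (x) p.38] -/
theorem isIsometry_vert (A : C π) (f : Over A) (hf : PreFrobenioid.IsIsometry (C.toElem π) f.hom) :
    PreFrobenioid.IsIsometry (C.toElem π) (vert π A f) :=
  isIsometry_of_norm_mul_tip_pow π _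
    ((A0.isIsometry_iff_norm_mul_tip_pow f.hom.fst).mp ((isIsometry_iff_fst π f.hom).mp hf))

/-- The slit inclusion `((id, 1, 1), id) : B^slit → B` is an isometry. [cite: MochizukiFrdII2008, Ex 3.3 (v) p.29] -/
theorem isIsometry_slitIncl (B : C π) (hB : B.fst.IsNaivelyIsotropic) (hc : B.fst.base = .complex) :
    PreFrobenioid.IsIsometry (C.toElem π) (slitIncl π B hB hc) :=
  isIsometry_of_norm_mul_tip_pow π _ (by
    change ‖((1 : ℂˣ) : ℂ)‖ * B.fst.tip ^ ((1 : ℕ+) : ℕ) = B.fst.tip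
    rw [Units.val_one, norm_one, one_mul, PNat.one_coe, pow_one])

/-- The degree-`2` Frobenius endomorphism `((id, 2, λ⁻¹), id)` is an isometry (`λ⁻¹ · λ² = λ`).
[cite: MochizukiFrdII2008, Ex 3.3 (ii) p.28] -/
theorem isIsometry_frobTwo (B : C π) (hB : B.fst.IsNaivelyIsotropic) :
    PreFrobenioid.IsIsometry (C.toElem π) (frobTwo π B hB) :=
  isIsometry_of_norm_mul_tip_pow π _ (by
    have ht : (0 : ℝ) < B.fst.tip := B.fst.tip_pos
    change ‖(((ofPosReal ℂ B.fst.region.tip)⁻¹ : ℂˣ) : ℂ)‖ * B.fst.tip ^ ((2 : ℕ+) : ℕ) = B.fst.tip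
    rw [Units.val_inv_eq_inv_val, norm_inv, coe_ofPosReal, RCLike.norm_ofReal,
      show ((2 : ℕ+) : ℕ) = 2 from rfl]
    change |B.fst.tip|⁻¹ * B.fst.tip ^ 2 = B.fst.tip
    rw [abs_of_pos ht, sq, ← mul_assoc, inv_mul_cancel₀ ht.ne', one_mul])

/-! ### Step 1 for `A`: lifting `D_{A_D}` into `A_A` -/

/-- The lift of `g : E → A_D` as an object of `A`. [cite: MochizukiFrdI2008, Prop. 1.13 (i) p.40] -/
noncomputable abbrev liftObjA (A : ArchFrd.A π) (g : Over A.obj.snd) : ArchFrd.A π := ⟨liftObj π A.obj g⟩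

/-- The lifted arrow `liftObjA g → A` of `A` (an isometry of `C`). [cite: MochizukiFrdI2008, Prop. 1.13 (i) p.40] -/
noncomputable def liftHomA (A : ArchFrd.A π) (g : Over A.obj.snd) : liftObjA π A g ⟶ A :=
  ⟨liftHom π A.obj g, isIsometry_liftHom π A.obj g⟩

/-- The lift of an arrow of `D_{A_D}` to `A`. [cite: MochizukiFrdI2008, Prop. 1.13 (i) p.40] -/
noncomputable def liftMapA (A : ArchFrd.A π) {g' g : Over A.obj.snd} (k : g' ⟶ g) :
    liftObjA π A g' ⟶ liftObjA π A g :=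
  ⟨liftMap π A.obj k, isIsometry_liftMap π A.obj k⟩

/-- The lift of `k` as an arrow of `A_A`. [cite: MochizukiFrdI2008, Prop. 1.13 (i) p.40] -/
noncomputable def liftOverA (A : ArchFrd.A π) {g' g : Over A.obj.snd} (k : g' ⟶ g) :
    Over.mk (liftHomA π A g') ⟶ Over.mk (liftHomA π A g) :=
  Over.homMk (liftMapA π A k) (InducedWideCategory.Hom.ext (liftMap_comp_liftHom π A.obj k))

/-- The natural automorphism of `D_{A_D} → D` induced by a natural automorphism of `A_A → A`.
[cite: MochizukiFrdI2008, Prop. 1.13 (i) p.40] -/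
noncomputable def baseAutoA (A : ArchFrd.A π) (α : Over.forget A ≅ Over.forget A) :
    Over.forget A.obj.snd ≅ Over.forget A.obj.snd :=
  NatIso.ofComponents
    (fun g => (CFP.proj₂ _ _).mapIso ((ArchFrd.A.ι π).mapIso (α.app (Over.mk (liftHomA π A g))))) (by
    intro g' g k
    exact congrArg (fun φ => CFP.Hom.snd (InducedWideCategory.Hom.hom φ))
      (α.hom.naturality (liftOverA π A k)))

/-- `D` slim ⇒ the lifted components have trivial `D`-part. [cite: MochizukiFrdI2008, Prop. 1.13 (i) p.40] -/
theorem snd_app_liftHomA (hD : IsSlim D) (A : ArchFrd.A π) (α : Over.forget A ≅ Over.forget A)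
    (g : Over A.obj.snd) : (α.app (Over.mk (liftHomA π A g))).hom.1.snd = 𝟙 g.left :=
  congrArg (fun γ : Over.forget A.obj.snd ≅ Over.forget A.obj.snd => γ.hom.app g)
    (hD.isRigid_forget A.obj.snd (baseAutoA π A α))

/-- The underlying object of `C_{A}` of an object of `A_A`. [cite: MochizukiFrdI2008, Prop. 1.13 (i) p.40] -/
noncomputable abbrev toOverC (A : ArchFrd.A π) (f : Over A) : Over A.obj := Over.mk f.hom.1

/-- The vertical arrow of an object `f` of `A_A` (an isometry, since `f` is). [cite: MochizukiFrdI2008, Prop. 1.13 (i) p.40] -/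
noncomputable def vertA (A : ArchFrd.A π) (f : Over A) :
    f.left ⟶ liftObjA π A (Over.mk f.hom.1.snd) :=
  ⟨vert π A.obj (toOverC π A f), isIsometry_vert π A.obj (toOverC π A f) f.hom.2⟩

/-- `vertA f ; liftHomA f_D = f`. [cite: MochizukiFrdI2008, Prop. 1.13 (i) p.40] -/
theorem vertA_comp_liftHomA (A : ArchFrd.A π) (f : Over A) :
    vertA π A f ≫ liftHomA π A (Over.mk f.hom.1.snd) = f.hom :=
  InducedWideCategory.Hom.ext (vert_comp_liftHom π A.obj (toOverC π A f))

/-- **Step 1 for `A`**: for `D` slim, every component of a natural automorphism of `A_A → A` lies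
over the identity of `D`. [cite: MochizukiFrdI2008, Prop. 1.13 (i) p.40] -/
theorem snd_app_eq_id_A (hD : IsSlim D) (A : ArchFrd.A π) (α : Over.forget A ≅ Over.forget A)
    (f : Over A) : (α.app f).hom.1.snd = 𝟙 f.left.obj.snd := by
  have hnat := α.hom.naturality (Over.homMk (vertA π A f) (vertA_comp_liftHomA π A f) :
    f ⟶ Over.mk (liftHomA π A (Over.mk f.hom.1.snd)))
  have h2 : (vertA π A f).1.snd ≫ (α.app (Over.mk (liftHomA π A (Over.mk f.hom.1.snd)))).hom.1.snd =
      (α.app f).hom.1.snd ≫ (vertA π A f).1.snd :=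
    congrArg (fun φ => CFP.Hom.snd (InducedWideCategory.Hom.hom φ)) hnat
  have h1 := snd_app_liftHomA π hD A α (Over.mk f.hom.1.snd)
  have e1 : (α.app f).hom.1.snd = (α.app f).hom.1.snd ≫ (vertA π A f).1.snd :=
    (Category.comp_id _).symm
  have e2 : (vertA π A f).1.snd ≫ (α.app (Over.mk (liftHomA π A (Over.mk f.hom.1.snd)))).hom.1.snd =
      𝟙 f.left.obj.snd := by
    rw [h1]
    exact Category.comp_id _
  exact e1.trans (h2.symm.trans e2)

/-! ### Steps 2 and 3 for `A` -/

/-- **Step 2 for `A`**: the underlying `C`-automorphism of a component is a unit of `C`.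
[cite: MochizukiFrdI2008, Prop. 1.13 (iii) p.40] -/
theorem mapIso_app_mem_unitsSubgroup (hD : IsSlim D) (A : ArchFrd.A π)
    (α : Over.forget A ≅ Over.forget A) (f : Over A) :
    (ArchFrd.A.ι π).mapIso (α.app f) ∈ PreFrobenioid.unitsSubgroup (C.toElem π) f.left.obj :=
  ⟨snd_app_eq_id_A π hD A α f, degFr_fst_eq_one π ((ArchFrd.A.ι π).mapIso (α.app f))⟩

/-- The slit inclusion as an arrow of `A`. [cite: MochizukiFrdII2008, Ex 3.3 (v) p.29] -/
noncomputable def slitInclA (B : ArchFrd.A π) (hB : B.obj.fst.IsNaivelyIsotropic)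
    (hc : B.obj.fst.base = .complex) : (⟨slitObj π B.obj hc⟩ : ArchFrd.A π) ⟶ B :=
  ⟨slitIncl π B.obj hB hc, isIsometry_slitIncl π B.obj hB hc⟩

/-- **Step 3 (a) for `A`**: at a complex naively isotropic object the scalar of a component is `1`.
[cite: MochizukiFrdII2008, Thm 3.6 (x) p.38] -/
theorem scalar_app_eq_one_of_complex_A (hD : IsSlim D) (A : ArchFrd.A π)
    (α : Over.forget A ≅ Over.forget A) (f : Over A) (hB : f.left.obj.fst.IsNaivelyIsotropic)
    (hc : f.left.obj.fst.base = .complex) : C0.scalar (α.app f).hom.1.fst = 1 := by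
  let f' : Over A := Over.mk (slitInclA π f.left hB hc ≫ f.hom)
  have hnat : slitInclA π f.left hB hc ≫ (α.app f).hom = (α.app f').hom ≫ slitInclA π f.left hB hc :=
    α.hom.naturality (Over.homMk (slitInclA π f.left hB hc) rfl : f' ⟶ f)
  have h1 : ((ArchFrd.A.ι π).mapIso (α.app f') : Aut f'.left.obj) = (1 : Aut f'.left.obj) :=
    UnitStab.eq_one_of_not_isNaivelyIsotropic π f'.left.obj
      (not_isNaivelyIsotropic_slitObj π f.left.obj hc) _ (mapIso_app_mem_unitsSubgroup π hD A α f')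
  have h1' : (α.app f').hom.1 = 𝟙 f'.left.obj := congrArg Iso.hom h1
  have h2 : slitIncl π f.left.obj hB hc ≫ (α.app f).hom.1 = slitIncl π f.left.obj hB hc := by
    have h3 : slitIncl π f.left.obj hB hc ≫ (α.app f).hom.1 =
        (α.app f').hom.1 ≫ slitIncl π f.left.obj hB hc :=
      congrArg InducedWideCategory.Hom.hom hnat
    rw [h3, h1']
    exact Category.id_comp _
  have h4 := congrArg (fun φ => C0.scalar (CFP.Hom.fst φ)) h2
  change C0.scalar ((slitIncl π f.left.obj hB hc).fst ≫ (α.app f).hom.1.fst) =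
    C0.scalar (slitIncl π f.left.obj hB hc).fst at h4
  rw [C0.scalar_comp'] at h4
  change D0.Hom.act (𝟙 f.left.obj.fst.base) (C0.scalar (α.app f).hom.1.fst) *
    1 ^ (C0.degFr (α.app f).hom.1.fst : ℕ) = 1 at h4
  rwa [act_id, one_pow, mul_one] at h4

/-- The degree-`2` Frobenius endomorphism as an arrow of `A`. [cite: MochizukiFrdII2008, Ex 3.3 (ii) p.28] -/
noncomputable def frobTwoA (B : ArchFrd.A π) (hB : B.obj.fst.IsNaivelyIsotropic) : B ⟶ B :=
  ⟨frobTwo π B.obj hB, isIsometry_frobTwo π B.obj hB⟩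

/-- **Step 3 (b) for `A`**: at a real object the scalar of a component is `1`.
[cite: MochizukiFrdII2008, Thm 3.6 (x) p.38] -/
theorem scalar_app_eq_one_of_real_A (hD : IsSlim D) (A : ArchFrd.A π)
    (α : Over.forget A ≅ Over.forget A) (f : Over A) (hr : f.left.obj.fst.base = .real) :
    C0.scalar (α.app f).hom.1.fst = 1 := by
  have hB : f.left.obj.fst.IsNaivelyIsotropic := f.left.obj.fst.isIsotropic_of_isReal hr
  let f' : Over A := Over.mk (frobTwoA π f.left hB ≫ f.hom)
  have hnat : frobTwoA π f.left hB ≫ (α.app f).hom = (α.app f').hom ≫ frobTwoA π f.left hB :=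
    α.hom.naturality (Over.homMk (frobTwoA π f.left hB) rfl : f' ⟶ f)
  have hu' := mapIso_app_mem_unitsSubgroup π hD A α f'
  have h : frobTwo π f.left.obj hB ≫ (α.app f).hom.1 = (α.app f').hom.1 ≫ frobTwo π f.left.obj hB :=
    congrArg InducedWideCategory.Hom.hom hnat
  have h' := congrArg (fun φ => C0.scalar (CFP.Hom.fst φ)) h
  change C0.scalar ((frobTwo π f.left.obj hB).fst ≫ (α.app f).hom.1.fst) =
    C0.scalar ((α.app f').hom.1.fst ≫ (frobTwo π f.left.obj hB).fst) at h'
  have hb' : C0.Base (α.app f').hom.1.fst = 𝟙 f'.left.obj.fst.base :=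
    UnitStab.base_fst_eq_id π _ _ hu'
  have hd : C0.degFr (α.app f).hom.1.fst = 1 := degFr_fst_eq_one π ((ArchFrd.A.ι π).mapIso (α.app f))
  rw [C0.scalar_comp', C0.scalar_comp', hb', hd] at h'
  change D0.Hom.act (𝟙 f.left.obj.fst.base) (C0.scalar (α.app f).hom.1.fst) *
      (ofPosReal ℂ f.left.obj.fst.region.tip)⁻¹ ^ ((1 : ℕ+) : ℕ) =
    D0.Hom.act (𝟙 f.left.obj.fst.base) (ofPosReal ℂ f.left.obj.fst.region.tip)⁻¹ *
      C0.scalar (α.app f').hom.1.fst ^ ((2 : ℕ+) : ℕ) at h'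
  rw [act_id, act_id, PNat.one_coe, pow_one, show ((2 : ℕ+) : ℕ) = 2 from rfl] at h'
  have hmem : C0.scalar (α.app f').hom.1.fst ∈ D0.scalars .real :=
    hr ▸ (α.app f').hom.1.fst.scalar_mem
  have hsq : C0.scalar (α.app f').hom.1.fst ^ 2 = 1 := by
    rcases UnitStab.eq_one_or_eq_neg_one_of_mem_scalars_real hmem
      (UnitStab.norm_scalar_eq_one π _ _ hu') with h1 | h1
    · rw [h1, one_pow]
    · rw [h1, neg_one_sq]
  rw [hsq, mul_one, mul_comm] at h'
  exact mul_left_cancel (h'.trans (mul_one _).symm)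

/-- **[FrdI] Prop. 1.13 (iii) for `A`**: for `D` slim, every component of a natural automorphism of
`A_A → A` is the identity. [cite: MochizukiFrdI2008, Prop. 1.13 (iii) p.40] -/
theorem app_eq_one_A (hD : IsSlim D) (A : ArchFrd.A π) (α : Over.forget A ≅ Over.forget A)
    (f : Over A) : (α.app f).hom = 𝟙 f.left := by
  have hu := mapIso_app_mem_unitsSubgroup π hD A α f
  have hC : ((ArchFrd.A.ι π).mapIso (α.app f) : Aut f.left.obj) = (1 : Aut f.left.obj) := by
    by_cases hX : f.left.obj.fst.IsNaivelyIsotropic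
    · have hc : C0.scalar (α.app f).hom.1.fst = 1 := by
        rcases D0.isReal_or_isComplex f.left.obj.fst.base with hr | hcx
        · exact scalar_app_eq_one_of_real_A π hD A α f hr
        · exact scalar_app_eq_one_of_complex_A π hD A α f hX hcx
      exact UnitStab.eq_of_scalar_eq π f.left.obj _ 1 hu (one_mem _) hc
    · exact UnitStab.eq_one_of_not_isNaivelyIsotropic π f.left.obj hX _ hu
  exact InducedWideCategory.Hom.ext (congrArg Iso.hom hC)

/-- **Theorem 3.6 (x) for the angular Frobenioid `A`** (PROVED, over any base `π : D → D₀`): `D` slim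
⇒ `A` slim. This is EXACTLY abc-iut-L1-t9's schema `ArchFrd.Thm36x` at `(MonoidType.Z, D, A π)`.
[cite: MochizukiFrdII2008, Thm 3.6 (x) p.38] -/
theorem thm36x_A : Thm36x MonoidType.Z D (ArchFrd.A π) := by
  intro hD _
  refine ⟨fun A α => ?_⟩
  apply Iso.ext
  apply NatTrans.ext
  funext f
  exact app_eq_one_A π hD A α f

end Angular

end Slim

end ArchFrd

end Literature.AlgebraicGeometry.Frobenioids
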